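import Summits.RiemannHypothesis.RiemannHypothesis.Theorems.TiltedLandingLaw421R2TrkD

/-! # TiltedLandingLaw421R2NodeD
W-08 round-2 NODE (C4 §K.2 D-instances + §K.4 `analyticHeredity_landed` + §K.7/§K.8 D-instances + C1 g23 §R2K: signed socket `RestBudgetGF`, primed twins `ZRestTrkDH′`/`ZRestTrkDHF′`/`AlphaSealTrkD′` over `ReadyR2`, nodes `RhW08.R2Node.law421T_of_round2D(F)` — CONDITIONAL compositions, nothing credited).
SUPPORT module for crux `TiltedLandingLaw421` (stmt-RiemannHypothesis-24774), `--supports` only: proves no stub, no crux; fully proved (no `sorry`).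
ROUND-2 DRY CUT by tenure rh-tenure-earlyapp-1 g5 (NOT keyed, NOT of record) from the single rc-0 base `R1K8R2KCheck-W08-C1-rh-idea-5-g23.lean` fef2bb59
(C1 RIDER-42 BASE-A): decl blocks byte-verbatim, base order, dependency closure of the round-2 nodes; K = kernel-checked lemmas about MODEL sockets (combs), not ζ/Ξ. RH is not proved. -/

-- ----- from C4 g24 §K.1–§K.3 5d82679f -----
-- ===== BEGIN C4 g24 sectionK-W08-C4-rh-idea-6-g24.part =====

namespace RhW08.StSwap

open Complex Set
open RhIdea6.G17.W07C7 RhIdea6.G17.W07C7.Rev6 RhIdea6.G18.W07C8.Law421BirthS RhIdea6.G19.W07C11.Seam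
open RhIdea6.G20.W07C12.Frac RhIdea6.G20.W07C12.StColP RhW07.C12.FieldSplit RhIdea6.G20.W07C13pre.Tent RhIdea6.G21.W07C13.TentMax
open RhW07.C14.TwoSided RhW07.C14.Classes RhW07.C14.Lineage

/-- W-08 round-2 support (E07: C4 g24 §K.1–§K.3 5d82679f): see the module docstring and the source README. -/
theorem stepInto_trkStepD : StepInto RhW08.Round1.TrkStepD StCol' := fun _ _ _ _ _ _ _ _ _ _ _ h => h.1

/-- W-08 round-2 support (E07: C4 g24 §K.1–§K.3 5d82679f): see the module docstring and the source README. -/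
theorem init0Sig_stTrkD : Init0Sig RhW08.Round1.StTrkD := init0Sig_chainOf RhW08.Round1.TrkStepD

/-- W-08 round-2 support (E07: C4 g24 §K.1–§K.3 5d82679f): see the module docstring and the source README. -/
theorem levelFinite_stTrkD : LevelFinite RhW08.Round1.StTrkD := levelFinite_chainOf stepInto_trkStepD

/-- W-08 round-2 support (E07: C4 g24 §K.1–§K.3 5d82679f): see the module docstring and the source README. -/
theorem upperStates_stTrkD : UpperStates RhW08.Round1.StTrkD := upperStates_chainOf stepInto_trkStepD

end RhW08.StSwap

-- ----- from C4 g24 §K.4 635298b7 -----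
-- ===== BEGIN C4 g24 sectionK4-W08-C4-rh-idea-6-g24.part =====

namespace RhW08.StSwap

open RhIdea6.G17.W07C7 RhIdea6.G17.W07C7.Rev6 RhIdea6.G18.W07C8.Law421BirthS RhIdea6.G19.W07C11.Seam

/-- analytic heredity is LANDED in the tree (`stub_analyticHeredity`, sorry-free). -/
theorem analyticHeredity_landed : AnalyticHereditySig := _root_.stub_analyticHeredity
end RhW08.StSwap

-- ----- from C4 g24 §K.8 -----
-- ===== BEGIN C4 g24 sectionK8-W08-C4-rh-idea-6-g24.part =====

namespace RhW08.StSwap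

open RhIdea6.G17.W07C7 RhIdea6.G17.W07C7.Rev6 RhIdea6.G18.W07C8.Law421BirthS RhIdea6.G19.W07C11.Seam
open RhIdea6.G20.W07C12.Frac RhIdea6.G20.W07C12.StColP RhW07.C12.FieldSplit RhIdea6.G21.W07C13.TentMax
open RhW07.C14.TwoSided RhW07.C14.Classes RhW07.C14.Lineage RhW07.C14.Booking
open Summit.RiemannHypothesis.RiemannHypothesis.Theorems.Splittings.EarlyAppointmentsLocalFourierPolya

/-- ★★★ (K) **ROUND-2 NODE TO THE CRUX BY NAME** over the down-first lineage `StTrkD` with stop Ready′ and the HEIGHT PURSE: for any co-seal `P`, 𝓔, σ with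
L2′ `LineageLawG P StTrkD ReadyR2 𝓔 σ T`, REST′ `RestBudgetG (1/4) P StTrkD ReadyR2 𝓔 σ (heightBudget T StTrkD) T` and α′ `IsolatedPairDropLowG (1/4) P StTrkD ReadyR2`
(T = tentMeterMax (3/2)) ⇒ `TiltedLandingLaw421`. (The old INIT♯ purse `slackBudget 1 T` is the special case `zRestTrkDH_of_zRestTrkD`-style.) -/
theorem law421T_of_lineageR2_trkD {P : StatePred} {𝓔 : LevelClass} {σ : LevelMeter}
    (hL : LineageLawG P RhW08.Round1.StTrkD ReadyR2 𝓔 σ (tentMeterMax (3 / 2)))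
    (hR : RestBudgetG (1 / 4) P RhW08.Round1.StTrkD ReadyR2 𝓔 σ (heightBudget (tentMeterMax (3 / 2)) RhW08.Round1.StTrkD) (tentMeterMax (3 / 2)))
    (hα : IsolatedPairDropLowG (1 / 4) P RhW08.Round1.StTrkD ReadyR2) :
    Summit.RiemannHypothesis.RiemannHypothesis.Theses.EarlyAppointments.TiltedLandingLaw421 :=
  law421T_of_descentSig3
    (descentSig3_of_lineageH le_rfl stateFree_readyR2 (landLe3_readyR2 _) levelFinite_stTrkD upperStates_stTrkD
      (initHeightG_heightBudget levelFinite_stTrkD init0Sig_stTrkD (tentMeterMax (3 / 2))) hL hR hα)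
    analyticHeredity_landed
end RhW08.StSwap

-- ----- from C1 g23 §R2K 0b76d7f2 -----
namespace RhW08.Round2

open Complex
open RhIdea6.G17.W07C7 RhIdea6.G17.W07C7.Rev6 RhIdea6.G18.W07C8.Law421BirthS RhIdea6.G19.W07C11.Seam
open RhIdea6.G20.W07C12.Frac RhIdea6.G20.W07C12.StColP RhW07.C12.FieldSplit RhIdea6.G21.W07C13.TentMax
open RhW07.C14.TwoSided RhW07.C14.Classes RhW07.C14.Lineage RhW07.C14.Booking
open RhW07.C13.Heredity RhIdea6.G22.W07C15pre.Injection RhW07.E3.Cell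
open RhW07.E3.Lit
open RhW08.Round1 RhW08.StSwap

section SignedToll

set_option linter.unusedVariables false in
open Classical in
/-- ★ (R-f) **REST BUDGET WITH SIGNED TOLLS**: token-identical to `RestBudgetG` (…E3Lineage.lean l.30) except `(∀ j, 0 ≤ lam j)` ↦ `(∀ j, -(μ * s) ≤ lam j)`:
a charged level whose tracked successor sits LOWER by d < μ·s is billed `1 − d/(μs)`; rises billed as before. -/
def RestBudgetGF (μ : ℝ) (P St Ready : StatePred) (𝓔 : LevelClass) (σ : LevelMeter) (β : Budget) (M : LevelMeter) : Prop :=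
  ∀ (η : ℝ) (f : ℂ → ℂ) (x₀ s hmax R Hs : ℝ) (B : ℕ), EngineHyps5 2 η f x₀ s hmax R Hs B →
    ∃ lam : ℕ → ℝ, (∀ j : ℕ, -(μ * s) ≤ lam j) ∧
      (∀ j : ℕ, Charged P St Ready η f x₀ s hmax R Hs B j →
        ∀ u : ℂ, St η f x₀ s hmax R Hs B j u → ¬ Ready η f x₀ s hmax R Hs B j u →
          ∃ u' : ℂ, St η f x₀ s hmax R Hs B (j + 1) u' ∧ |u'.im| ≤ |u.im| + lam j) ∧
      ∀ k : ℕ, σ η f x₀ s hmax R Hs B k + (∑ j ∈ Finset.range k,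
          (if Charged P St Ready η f x₀ s hmax R Hs B j then
              (if 𝓔 η f x₀ s hmax R Hs B j then (1 : ℝ) else 0) + lam j / (μ * s) else 0))
        ≤ β η f x₀ s hmax R Hs B

/-- (K) unit tolls ⇒ signed tolls. -/
theorem restBudgetGF_of_restBudgetG {μ : ℝ} (hμ : 0 ≤ μ) {P St Ready : StatePred} {𝓔 : LevelClass} {σ : LevelMeter} {β : Budget}
    {M : LevelMeter} (h : RestBudgetG μ P St Ready 𝓔 σ β M) : RestBudgetGF μ P St Ready 𝓔 σ β M := by
  intro η f x₀ s hmax R Hs B hE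
  have hs : 0 < s := hE.2.2.2.1
  obtain ⟨lam, hlam0, hsucc, hrest⟩ := h η f x₀ s hmax R Hs B hE
  refine ⟨lam, fun j => ?_, hsucc, hrest⟩
  have h1 := hlam0 j
  have h2 : 0 ≤ μ * s := mul_nonneg hμ hs.le
  linarith

open Classical in
/-- ★★ (R-f, K) **LINEAGE with SIGNED rest ⇒ FRAC CENSUS (datum purse `M 0 + β`), DIRECTLY** — the signed twin of C4's `fracCensusB_of_lineage`:
per-level charge `[Charged j]·(1 + lam j/(μs)) ≥ 0` because `lam j ≥ −μ·s`; prefix Σ = injected + Σ[Charged](𝟙𝓔 + lam/(μs)) ≤ (M 0 + σ k) + (β − σ k). -/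
theorem fracCensusB_of_lineageF {μ : ℝ} (hμ : 0 < μ) {P St Ready : StatePred} (hSF : StateFree Ready) (hU : UpperStates St)
    (hLow : HasLowestSig St) {𝓔 : LevelClass} {σ : LevelMeter} {β : Budget} {M : LevelMeter}
    (hL : LineageLawG P St Ready 𝓔 σ M) (hR : RestBudgetGF μ P St Ready 𝓔 σ β M) (hα : IsolatedPairDropLowG μ P St Ready) :
    FracCensusSigB (fun η f x₀ s hmax R Hs B => M η f x₀ s hmax R Hs B 0 + β η f x₀ s hmax R Hs B) (VLin μ) St Ready := by
  intro η f x₀ s hmax R Hs B hE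
  have hs : 0 < s := hE.2.2.2.1
  have hμs : 0 < μ * s := mul_pos hμ hs
  obtain ⟨lam, hlamF, hsucc, hrest⟩ := hR η f x₀ s hmax R Hs B hE
  have hlin := hL η f x₀ s hmax R Hs B hE
  refine ⟨fun j => if Charged P St Ready η f x₀ s hmax R Hs B j then 1 + lam j / (μ * s) else 0, ?_, ?_, ?_⟩
  · intro j
    show 0 ≤ (if Charged P St Ready η f x₀ s hmax R Hs B j then 1 + lam j / (μ * s) else 0)
    by_cases hc : Charged P St Ready η f x₀ s hmax R Hs B j
    · rw [if_pos hc]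
      have h1 : -(μ * s) / (μ * s) ≤ lam j / (μ * s) := div_le_div_of_nonneg_right (hlamF j) hμs.le
      rw [neg_div, div_self hμs.ne'] at h1
      linarith
    · rw [if_neg hc]
  · intro N
    show (∑ j ∈ Finset.range N, (if Charged P St Ready η f x₀ s hmax R Hs B j then 1 + lam j / (μ * s) else 0))
      ≤ M η f x₀ s hmax R Hs B 0 + β η f x₀ s hmax R Hs B
    have hsplit : ∀ j : ℕ,
        (if Charged P St Ready η f x₀ s hmax R Hs B j then 1 + lam j / (μ * s) else 0)
          = (if Charged P St Ready η f x₀ s hmax R Hs B j ∧ ¬ 𝓔 η f x₀ s hmax R Hs B j then (1 : ℝ) else 0)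
            + (if Charged P St Ready η f x₀ s hmax R Hs B j then
                (if 𝓔 η f x₀ s hmax R Hs B j then (1 : ℝ) else 0) + lam j / (μ * s) else 0) := by
      intro j
      by_cases hc : Charged P St Ready η f x₀ s hmax R Hs B j
      · by_cases he : 𝓔 η f x₀ s hmax R Hs B j
        · rw [if_pos hc, if_neg (fun h : Charged P St Ready η f x₀ s hmax R Hs B j ∧ ¬ 𝓔 η f x₀ s hmax R Hs B j => h.2 he),
            if_pos hc, if_pos he]
          ring
        · rw [if_pos hc, if_pos (show Charged P St Ready η f x₀ s hmax R Hs B j ∧ ¬ 𝓔 η f x₀ s hmax R Hs B j from ⟨hc, he⟩),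
            if_pos hc, if_neg he]
          ring
      · rw [if_neg hc, if_neg (fun h : Charged P St Ready η f x₀ s hmax R Hs B j ∧ ¬ 𝓔 η f x₀ s hmax R Hs B j => hc h.1), if_neg hc]
        ring
    have hsum : (∑ j ∈ Finset.range N, (if Charged P St Ready η f x₀ s hmax R Hs B j then 1 + lam j / (μ * s) else 0))
        = (∑ j ∈ Finset.range N, (if Charged P St Ready η f x₀ s hmax R Hs B j ∧ ¬ 𝓔 η f x₀ s hmax R Hs B j then (1 : ℝ) else 0))
          + ∑ j ∈ Finset.range N, (if Charged P St Ready η f x₀ s hmax R Hs B j then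
                (if 𝓔 η f x₀ s hmax R Hs B j then (1 : ℝ) else 0) + lam j / (μ * s) else 0) := by
      rw [← Finset.sum_add_distrib]
      exact Finset.sum_congr rfl (fun j _ => hsplit j)
    rw [hsum]
    have h1 := hlin N
    have h2 := hrest N
    linarith
  · intro j u hu hnr
    by_cases hc : Charged P St Ready η f x₀ s hmax R Hs B j
    · obtain ⟨u', hu', hle⟩ := hsucc j hc u hu hnr
      refine ⟨u', hu', ?_⟩
      show |u'.im| / (μ * s) + 1 ≤ |u.im| / (μ * s) + (if Charged P St Ready η f x₀ s hmax R Hs B j then 1 + lam j / (μ * s) else 0)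
      rw [if_pos hc]
      have h1 : |u'.im| / (μ * s) ≤ (|u.im| + lam j) / (μ * s) := div_le_div_of_nonneg_right hle hμs.le
      rw [add_div] at h1
      linarith
    · obtain ⟨v, hv⟩ := hLow η f x₀ s hmax R Hs B hE j u hu
      have hnrv : ¬ Ready η f x₀ s hmax R Hs B j v := fun h => hnr (hSF η f x₀ s hmax R Hs B j v u h)
      have hPv : P η f x₀ s hmax R Hs B j v := by
        by_contra hP
        exact hc ⟨v, hv, hnrv, hP⟩
      obtain ⟨u', hu', hdrop⟩ := hα η f x₀ s hmax R Hs B hE j v hv hnrv hPv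
      refine ⟨u', hu', ?_⟩
      show |u'.im| / (μ * s) + 1 ≤ |u.im| / (μ * s) + (if Charged P St Ready η f x₀ s hmax R Hs B j then 1 + lam j / (μ * s) else 0)
      rw [if_neg hc, add_zero]
      have hv0 : 0 < v.im := hU η f x₀ s hmax R Hs B j v hv.1
      have hu0 : 0 < u.im := hU η f x₀ s hmax R Hs B j u hu
      have hvu : |v.im| ≤ |u.im| := by
        rw [abs_of_pos hv0, abs_of_pos hu0]
        exact hv.2 u hu
      have h1 : (|u'.im| + μ * s) / (μ * s) ≤ |u.im| / (μ * s) := div_le_div_of_nonneg_right (hdrop.trans hvu) hμs.le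
      rw [add_div, div_self hμs.ne'] at h1
      exact h1

/-- ★★ (R-f + t3, K) the signed twin of C4's `descentSig3_of_lineageH`: INIT_H ∧ L2 ∧ REST_F ∧ α over an upper-half-plane lineage with lowest states and a
state-free stop carrying `LandLe3` ⇒ DescentSig‴. -/
theorem descentSig3_of_lineageHF {μ : ℝ} (hμ : 1 / 4 ≤ μ) {P St Ready : StatePred} (hSF : StateFree Ready) (hLand : LandLe3 St Ready)
    (hU : UpperStates St) (hLow : HasLowestSig St) {𝓔 : LevelClass} {σ : LevelMeter} {β : Budget} {M : LevelMeter}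
    (hI : InitHeightG μ 1 β M St) (hL : LineageLawG P St Ready 𝓔 σ M) (hR : RestBudgetGF μ P St Ready 𝓔 σ β M)
    (hα : IsolatedPairDropLowG μ P St Ready) : DescentSig3 := by
  have hμ0 : 0 < μ := by linarith
  refine descentSig3_of_fracCensusB (fun η f x₀ s hmax R Hs B => M η f x₀ s hmax R Hs B 0 + β η f x₀ s hmax R Hs B) (VLin μ) St
    Ready (vNonneg_lin hμ0 St) ?_ (fracCensusB_of_lineageF hμ0 hSF hU hLow hL hR hα) hLand
  intro η f x₀ s hmax R Hs B hE
  obtain ⟨u₀, hSt0, hle⟩ := hI η f x₀ s hmax R Hs B hE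
  refine ⟨u₀, hSt0, ?_⟩
  simp only [VLin]
  linarith
end SignedToll

section Monotone

/-- (K) the α-socket is ANTITONE in Ready. -/
theorem isolatedPairDropLowG_anti_ready {μ : ℝ} {P St Ready Ready' : StatePred}
    (hR : ∀ (η : ℝ) (f : ℂ → ℂ) (x₀ s hmax R Hs : ℝ) (B j : ℕ) (u : ℂ),
      Ready η f x₀ s hmax R Hs B j u → Ready' η f x₀ s hmax R Hs B j u)
    (h : IsolatedPairDropLowG μ P St Ready) : IsolatedPairDropLowG μ P St Ready' :=
  fun η f x₀ s hmax R Hs B hE j v hlow hnr hp => h η f x₀ s hmax R Hs B hE j v hlow (fun hr => hnr (hR _ _ _ _ _ _ _ _ _ _ hr)) hp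
end Monotone

section PrimedTwins

/-- W-08 round-2 support (E07: C1 g23 §R2K 0b76d7f2): see the module docstring and the source README. -/
noncomputable def SigmaMinTrkD' : LevelMeter := sigmaMin PTrkD StTrkD ReadyR2 EmptyTrkD (tentMeterMax (3 / 2))

/-- round-2 REST family, UNIT tolls, HEIGHT purse (C4 §K.7 `heightBudget`). -/
def RestTrkD' (𝓔₂ : LevelClass) (σ : LevelMeter) : Prop :=
  RestBudgetG (1 / 4) PTrkD StTrkD ReadyR2 𝓔₂ σ (heightBudget (tentMeterMax (3 / 2)) StTrkD) (tentMeterMax (3 / 2))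

/-- round-2 REST family, SIGNED tolls (R-f), HEIGHT purse. -/
def RestTrkDF' (𝓔₂ : LevelClass) (σ : LevelMeter) : Prop :=
  RestBudgetGF (1 / 4) PTrkD StTrkD ReadyR2 𝓔₂ σ (heightBudget (tentMeterMax (3 / 2)) StTrkD) (tentMeterMax (3 / 2))

/-- ★★ `ZRestTrkDH′` — REST, round 2: unit tolls, stop Ready′, height purse (C4's suggested stub name). -/
def ZRestTrkDH' : Prop := RestTrkD' EmptyTrkD SigmaMinTrkD'

/-- ★★ `ZRestTrkDHF′` — REST, round 2: SIGNED tolls, stop Ready′, height purse (C1's (R-f) flavour; WEAKER as a hypothesis). -/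
def ZRestTrkDHF' : Prop := RestTrkDF' EmptyTrkD SigmaMinTrkD'

/-- W-08 round-2 support (E07: C1 g23 §R2K 0b76d7f2): see the module docstring and the source README. -/
def AlphaTrkD' : Prop := IsolatedPairDropLowG (1 / 4) PTrkD StTrkD ReadyR2

/-- ★ `AlphaSealTrkD′` — α, round 2 (stop Ready′): STUB. -/
def AlphaSealTrkD' : Prop := IsolatedPairDropLowG (1 / 4) PSealC4 StTrkD ReadyR2

/-- W-08 round-2 support (E07: C1 g23 §R2K 0b76d7f2): see the module docstring and the source README. -/
theorem alphaTrkD'_of (h : AlphaSealTrkD') : AlphaTrkD' := isolatedPairDropLowG_pOr_succOf h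

/-- (K) round-1 α ⇒ round-2 α (hand-α / HeightLemma work carries over). -/
theorem alphaSealTrkD'_of_r1 (h : AlphaSealTrkD) : AlphaSealTrkD' :=
  isolatedPairDropLowG_anti_ready (fun _ _ _ _ _ _ _ _ _ _ hr => readyR2_of_cumReady_windowReady _ _ _ _ _ _ _ _ _ _ hr) h

/-- (K) unit ⇒ signed. -/
theorem zRestTrkDHF'_of (h : ZRestTrkDH') : ZRestTrkDHF' :=
  restBudgetGF_of_restBudgetG (P := PTrkD) (St := StTrkD) (Ready := ReadyR2) (𝓔 := EmptyTrkD) (σ := SigmaMinTrkD')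
    (β := heightBudget (tentMeterMax (3 / 2)) StTrkD) (M := tentMeterMax (3 / 2)) (by norm_num) h

/-- ★ (K) L2′ with ITS σ_min: a theorem (`lineageLawG_sigmaMin` verbatim). -/
theorem lineageLawTrkD' : LineageLawG PTrkD StTrkD ReadyR2 EmptyTrkD SigmaMinTrkD' (tentMeterMax (3 / 2)) := lineageLawG_sigmaMin
end PrimedTwins

end RhW08.Round2

namespace RhW08.R2Node

open RhIdea6.G21.W07C13.TentMax RhW08.StSwap

/-- ★★★ (unit tolls + height purse) — literally C4's `law421T_of_lineageR2_trkD` at (P, 𝓔, σ) := (PTrkD, EmptyTrkD, SigmaMinTrkD′). -/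
theorem law421T_of_round2D (hR : RhW08.Round2.ZRestTrkDH') (hα : RhW08.Round2.AlphaSealTrkD') :
    Summit.RiemannHypothesis.RiemannHypothesis.Theses.EarlyAppointments.TiltedLandingLaw421 :=
  law421T_of_lineageR2_trkD RhW08.Round2.lineageLawTrkD' hR (RhW08.Round2.alphaTrkD'_of hα)

/-- ★★★ (SIGNED tolls + height purse). -/
theorem law421T_of_round2DF (hR : RhW08.Round2.ZRestTrkDHF') (hα : RhW08.Round2.AlphaSealTrkD') :
    Summit.RiemannHypothesis.RiemannHypothesis.Theses.EarlyAppointments.TiltedLandingLaw421 :=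
  law421T_of_descentSig3
    (RhW08.Round2.descentSig3_of_lineageHF le_rfl stateFree_readyR2 (landLe3_readyR2 _) upperStates_stTrkD
      (hasLowestSig_of_levelFinite levelFinite_stTrkD)
      (initHeightG_heightBudget levelFinite_stTrkD init0Sig_stTrkD (tentMeterMax (3 / 2))) RhW08.Round2.lineageLawTrkD' hR
      (RhW08.Round2.alphaTrkD'_of hα))
    analyticHeredity_landed
end RhW08.R2Node
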